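import Summits.RiemannHypothesis.RiemannHypothesis.Theses.WeilComb
import Summits.RiemannHypothesis.RiemannHypothesis.Theorems.WeilCombCombShapeDetection
import Literature.NumberTheory.LFunctions.WeilCriterionConverse
import Literature.NumberTheory.LFunctions.WeilExplicitFormulaProofs
import Literature.NumberTheory.LFunctions.WeilMellinBounds

/-!
# Stub `stub_symbolExpSum` (plan T1) for crux `WeilComb.CombShapePositivity`
(item stmt-RiemannHypothesis-11229, route route-RiemannHypothesis-WeilComb, line `Sketch`,
stub-plan `Cruxes/CombShapePositivity/STUB-PLAN-stub_fejer.md`, tier T1)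

**The comb symbol is the zero-side exponential series.** For the route's bump
`φ_ε(t) = ε⁻¹ expNegInvGlue (1 − (t/ε)²)` and every real `x`,

  `W(τ_x (φ_ε ⋆ φ̃_ε)) = B_{φ_ε}(x) = Σ_ρ m(ρ) P_{φ_ε}(ρ) e^{(ρ − 1/2) x}`

(`WeilConverse.expSum`), where `P_g(ρ) = ĝ(ρ) conj ĝ(1 − ρ̄)` (`WeilConverse.pairCoeff`).

Proof: `k = τ_x(φ_ε ⋆ φ̃_ε)` is a Weil test; by the explicit formula (`explicit_formula_holds`) the
symmetric zero sums of `k̂` converge to `W(k)`; they also converge to the absolutely convergent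
series `Σ_ρ m(ρ) k̂(ρ)` (`hasWeilZeroSide_tsum`, `summable_norm_zeroSide`); limits are unique, and
termwise `k̂(ρ) = e^{(ρ−1/2)x} (φ_ε ⋆ φ̃_ε)^(ρ) = e^{(ρ−1/2)x} P_{φ_ε}(ρ)` (`weilMellin_weilTranslate`,
`weilMellin_weilQuadratic`). The case `x = 0` is `combShapeDetection_zeroForm_eq_weilQuadratic`.
Consequence recorded here: the symbol `x ↦ W(τ_x(φ_ε ⋆ φ̃_ε))` is continuous
(`combShapeDetection_continuous_expSum`).
-/

noncomputable section

-- the sub-problem path RiemannHypothesis/RiemannHypothesis duplicates a namespace (D-0017)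
set_option linter.dupNamespace false

open scoped BigOperators ComplexConjugate
open Complex MeasureTheory Set Filter

namespace Summit.RiemannHypothesis.RiemannHypothesis.Theorems.WeilCombBohrFejer

open Literature.NumberTheory.LFunctions
open Literature.NumberTheory.LFunctions.WeilConverse

/-- `W(τ_x (g ⋆ g̃)) = B_g(x) = Σ_ρ m(ρ) P_g(ρ) e^{(ρ−½)x}` for every Weil test `g` and real `x`
(explicit formula for the test `τ_x(g ⋆ g̃)`, absolute convergence of its zero side, uniqueness of
limits, `weilMellin_weilTranslate`, `weilMellin_weilQuadratic`). [folklore] -/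
theorem weilFunctional_weilTranslate_autocorr_eq_expSum {g : ℝ → ℂ} (hg : IsWeilTest g) (x : ℝ) :
    weilFunctional (weilTranslate (weilConv g (weilReflect g)) x) = expSum g x := by
  have hk : IsWeilTest (weilTranslate (weilConv g (weilReflect g)) x) :=
    (hg.weilConv hg.weilReflect).weilTranslate x
  have h1 : HasWeilZeroSide (weilTranslate (weilConv g (weilReflect g)) x)
      (weilFunctional (weilTranslate (weilConv g (weilReflect g)) x)) :=
    explicit_formula_holds hk
  have h2 := hasWeilZeroSide_tsum (summable_norm_zeroSide hk)
  rw [tendsto_nhds_unique h1 h2, expSum]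
  refine tsum_congr fun ρ => ?_
  rw [weilMellin_weilTranslate, weilMellin_weilQuadratic hg, pairCoeff]
  ring

/-- **T1 `stub_symbolExpSum`** (registered stub of crux stmt-RiemannHypothesis-11229, plan tier T1):
`W(τ_x (φ_ε ⋆ φ̃_ε)) = WeilConverse.expSum φ_ε x = Σ_ρ m(ρ) P_{φ_ε}(ρ) e^{(ρ−½)x}` for every real `x`
(the hypothesis `0 < ε` is part of the registered signature and not needed). [folklore] -/
theorem stub_symbolExpSum : ∀ ε : ℝ, 0 < ε → ∀ x : ℝ,
    weilFunctional (weilTranslate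
      (weilConv (fun t : ℝ => (ε : ℂ)⁻¹ * ((expNegInvGlue (1 - (t / ε) ^ 2) : ℝ) : ℂ))
        (weilReflect (fun t : ℝ => (ε : ℂ)⁻¹ * ((expNegInvGlue (1 - (t / ε) ^ 2) : ℝ) : ℂ)))) x) =
      Literature.NumberTheory.LFunctions.WeilConverse.expSum
        (fun t : ℝ => (ε : ℂ)⁻¹ * ((expNegInvGlue (1 - (t / ε) ^ 2) : ℝ) : ℂ)) x :=
  fun ε _ x =>
    weilFunctional_weilTranslate_autocorr_eq_expSum (combShapeDetection_shapeBump_isWeilTest ε) x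

/-- Corollary of `stub_symbolExpSum`: the comb symbol `x ↦ W(τ_x (φ_ε ⋆ φ̃_ε))` is continuous on `ℝ`
(`combShapeDetection_continuous_expSum`; no sign condition on `ε`). [folklore] -/
theorem continuous_symbol (ε : ℝ) :
    Continuous fun x : ℝ => weilFunctional (weilTranslate
      (weilConv (fun t : ℝ => (ε : ℂ)⁻¹ * ((expNegInvGlue (1 - (t / ε) ^ 2) : ℝ) : ℂ))
        (weilReflect (fun t : ℝ => (ε : ℂ)⁻¹ * ((expNegInvGlue (1 - (t / ε) ^ 2) : ℝ) : ℂ)))) x) := by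
  have e : (fun x : ℝ => weilFunctional (weilTranslate
      (weilConv (fun t : ℝ => (ε : ℂ)⁻¹ * ((expNegInvGlue (1 - (t / ε) ^ 2) : ℝ) : ℂ))
        (weilReflect (fun t : ℝ => (ε : ℂ)⁻¹ * ((expNegInvGlue (1 - (t / ε) ^ 2) : ℝ) : ℂ)))) x)) =
      expSum (fun t : ℝ => (ε : ℂ)⁻¹ * ((expNegInvGlue (1 - (t / ε) ^ 2) : ℝ) : ℂ)) :=
    funext fun x =>
      weilFunctional_weilTranslate_autocorr_eq_expSum (combShapeDetection_shapeBump_isWeilTest ε) x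
  rw [e]
  exact combShapeDetection_continuous_expSum (combShapeDetection_shapeBump_isWeilTest ε)

end Summit.RiemannHypothesis.RiemannHypothesis.Theorems.WeilCombBohrFejer

end
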